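import Literature.Algebra.Homology.HopfTraceFormulaBaseChange
import Literature.Algebra.Homology.EulerPoincareFormula
import HarnessLib

/-!
# The Euler characteristic is independent of the coefficient field: `χ_H(K ⊗_R C) = χ(C)` in `ℤ`

Layer `Literature/Algebra/Homology` (pure algebra over Mathlib; proved theorems only, 0 definitions, 0 named facts, no instances, no notation).
For a commutative ring `R`, a field `K`, ANY ring map `f : R →+* K` (flatness and injectivity are NOT needed: `ℤ → 𝔽_p` is allowed) and a
homological complex `C` of finitely generated free `R`-modules, of any shape with `EulerCharSigns` and finitely many non-zero ranks:

* `eulerChar_extendScalars : (K ⊗_R C).eulerChar = C.eulerChar` — termwise `dim_K (K ⊗_R Cᵢ) = rank_R Cᵢ` (row `HopfTraceFormulaBaseChange`'s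
  `finrank_extendScalars_obj`);
* **`homologyEulerChar_extendScalars : χ_H(K ⊗_R C) = C.eulerChar` in `ℤ`** — row `EulerPoincareFormula` over `K` + the previous item. Row
  `HopfTraceFormulaBaseChange`'s `map_finsum_χ_smul_finrank_eq_homologyEulerChar` states this only AFTER casting through `f` into `K`, which for
  `K = 𝔽_p` is a congruence modulo `p`; the integer statement is recorded here;
* **`homologyEulerChar_extendScalars_eq_homologyEulerChar_extendScalars`** — for two fields `K₁`, `K₂` and ring maps `fⱼ : R →+* Kⱼ`,
  `χ_H(K₁ ⊗_R C) = χ_H(K₂ ⊗_R C)`: e.g. `χ_H(𝔽_p ⊗ C) = χ_H(ℚ ⊗ C)` for a complex of finitely generated free abelian groups, although the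
  individual Betti numbers depend on the field (over a ring with rank–nullity both also equal `χ_H(C)`, row `EulerPoincareRank`; not imported here).

`[(ModuleCat.extendScalars f).Additive]` is an instance HYPOTHESIS as in row `HopfTraceFormulaBaseChange`. Library only (cell `pub-hodge-ring2`,
count-neutral); proves nothing about any crux, route or conjecture.

## References

* A. Hatcher, *Algebraic Topology* (2002), Thm. 2.44, §2.C and Cor. 3A.6 (b) (Betti numbers mod `p` vs. rational). [HatcherAT2002]
* E. H. Spanier, *Algebraic Topology* (1981), Ch. 4 §3 Thm. 14, Ch. 5 §2 (universal coefficients). [Spanier1981]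
-/

open CategoryTheory CategoryTheory.Limits

universe v u₁ u₂ u₃ w

namespace Literature.Algebra.Homology.HopfTrace

variable {R : Type u₁} [CommRing R] {K : Type u₂} [Field K] (f : R →+* K) {ι : Type w} {c : ComplexShape ι} [c.EulerCharSigns]
  [(ModuleCat.extendScalars.{u₁, u₂, v} f).Additive] (C : HomologicalComplex (ModuleCat.{v} R) c)
  [∀ i, Module.Free R (C.X i)] [∀ i, Module.Finite R (C.X i)]

/-- **`χ(K ⊗_R C) = χ(C)`** on chains: `dim_K (K ⊗_R Cᵢ) = rank_R Cᵢ` termwise (no finiteness of support needed: both sides are the same `finsum`).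
[cite: HatcherAT2002, Thm. 2.44] -/
theorem eulerChar_extendScalars : (((ModuleCat.extendScalars f).mapHomologicalComplex c).obj C).eulerChar = C.eulerChar := by
  simp only [HomologicalComplex.eulerChar, GradedObject.eulerChar]
  exact finsum_congr fun i => by rw [Functor.mapHomologicalComplex_obj_X, finrank_extendScalars_obj]

/-- **The Euler characteristic is independent of the coefficient field, integer form**: `χ_H(K ⊗_R C) = χ(C) = Σᶠ χ(i) rank_R Cᵢ` in `ℤ`, for
finitely generated free terms with finitely many non-zero ranks and ANY ring map `f : R →+* K` to a field.
[cite: HatcherAT2002, Thm. 2.44] [cite: Spanier1981, Ch. 4 §3 Thm. 14] -/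
theorem homologyEulerChar_extendScalars (hC : (GradedObject.finrankSupport C.X).Finite) :
    (((ModuleCat.extendScalars f).mapHomologicalComplex c).obj C).homologyEulerChar = C.eulerChar := by
  haveI : ∀ i, Module.Finite K ((((ModuleCat.extendScalars f).mapHomologicalComplex c).obj C).X i) := fun i =>
    moduleFinite_extendScalars_obj f (C.X i)
  rw [← EulerPoincare.eulerChar_eq_homologyEulerChar _ (hC.subset (finrankSupport_extendScalars_subset f C)), eulerChar_extendScalars]

/-- `Finset` form: `Σ_{i ∈ s} χ(i) dim_K Hᵢ(K ⊗_R C) = Σ_{i ∈ s} χ(i) rank_R Cᵢ` when `s` carries the ranks of `C`. [cite: HatcherAT2002, Thm. 2.44] -/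
theorem sum_χ_mul_finrank_homology_extendScalars_eq (s : Finset ι) (hC : GradedObject.finrankSupport C.X ⊆ s) :
    ∑ i ∈ s, (c.χ i : ℤ) * (Module.finrank K ((((ModuleCat.extendScalars f).mapHomologicalComplex c).obj C).homology i) : ℤ) =
      ∑ i ∈ s, (c.χ i : ℤ) * (Module.finrank R (C.X i) : ℤ) := by
  haveI : ∀ i, Module.Finite K ((((ModuleCat.extendScalars f).mapHomologicalComplex c).obj C).X i) := fun i =>
    moduleFinite_extendScalars_obj f (C.X i)
  have hC' := (finrankSupport_extendScalars_subset f C).trans hC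
  rw [← HomologicalComplex.homologyEulerChar_eq_sum_finSet_of_finrankSupport_subset _ s
      ((EulerPoincare.finrankSupport_homology_subset _).trans hC'),
    ← C.eulerChar_eq_sum_finSet_of_finrankSupport_subset s hC]
  exact homologyEulerChar_extendScalars f C (s.finite_toSet.subset hC)

/-- **Two coefficient fields give the same Euler characteristic**: `χ_H(K₁ ⊗_R C) = χ_H(K₂ ⊗_R C)` for any fields `K₁`, `K₂` receiving `R`
(e.g. `𝔽_p` and `ℚ` for a complex of finitely generated free abelian groups), although the Betti numbers themselves depend on the field.
[cite: HatcherAT2002, Cor. 3A.6] [cite: Spanier1981, Ch. 5 §2] -/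
theorem homologyEulerChar_extendScalars_eq_homologyEulerChar_extendScalars {K₂ : Type u₃} [Field K₂] (f₂ : R →+* K₂)
    [(ModuleCat.extendScalars.{u₁, u₃, v} f₂).Additive] (hC : (GradedObject.finrankSupport C.X).Finite) :
    (((ModuleCat.extendScalars f).mapHomologicalComplex c).obj C).homologyEulerChar =
      (((ModuleCat.extendScalars f₂).mapHomologicalComplex c).obj C).homologyEulerChar := by
  rw [homologyEulerChar_extendScalars f C hC, homologyEulerChar_extendScalars f₂ C hC]

end Literature.Algebra.Homology.HopfTrace
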